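/-
Copyright: statement-level skeleton of a published paper (lit-balaban cell, Phase-2 proof seat p19, gen 4). No claims beyond
what the kernel checks below.
-/
import Mathlib
import Literature.MathematicalPhysics.QuantumFieldTheory.Balaban1983to89.B3IBPSites

/-!
# B3 — T. Bałaban, *(Higgs)₂,₃ quantum fields in a finite volume. III. Renormalization*, CMP **88** (1983) 411–445
[Balaban1983Higgs3] — Sect. 2, pp. 425–426: the (2.4)-subgraphs along an ordering, the count data of the graphs `G′∗`
produced by the integration by parts (2.8)/(2.9), and their degrees: *"the graphs (2.4) are replaced by the graphs with
degree +1 … the degrees of these graphs are ≥ D(G₀)"*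

statement-level skeleton of published theorems with citation tags; proofs where landed; nothing here is a claim about
the Yang–Mills mass gap

PDF held: `paper:balaban1983-higgs-2-3-quantum-fields-finite-volume` (journal page = PDF page + 410); the sentences of
pp. 425–426 read on the ×2 renders `pub-balaban/b2b-balaban-ref1/pages/1983-cmp88-higgs23-III/1983-cmp88-higgs23-III-p015,
p016-x2.png`.

Part of the Phase-2 work on SKELETON rows **B3.Prop2.1 / B3.Prop2.2** (unit `lit-balaban-p19` gen 4, HOME
`run/shared/lean/pub/lit-balaban/`): the (2.4) EXCEPTION of Proposition 2.1, files `B3LatticeIBP` → `B3AmpIBP` →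
`B3AmpIBPClosed` → `B3AmpIBPAll` → `B3IBPSites` → `B3IBPDegrees` (this file) → `B3AmpIBPBounds` → `B3Prop21Except24`; over the count data
`B3Ineq215.Counts` (gen 2) and their blocks `G_i` (`B3Ineq215Quotient`), the ℚ-degrees `degQ` (`B3Prop21Instance`).

WHAT IS REPRODUCED.  p. 425 [PDF 15], verbatim: *"The effect of this transformation is that the graphs (2.4) are replaced by
the graphs with degree +1. … if the graph (2.4) is a subgraph of some graph G₀, then after the transformation (2.9) G₀ is
represented as a sum of three graphs and the degrees of these graphs are ≧ D(G₀). It is so because the degrees of the vertices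
on the right side of (2.8) or (2.9) are bigger or equal to the degree of the left side. From this it follows that for each
graph G′∗ the subgraphs G₁, G₂, …, G_m = G′∗ defined as previously have positive degrees."*  KERNEL-CHECKED HERE, on the count data:
* (the sites and the (2.4)-blocks are in `B3IBPSites`);
* the COUNT DATUM OF `G′∗_c` (`moveCounts G S c`): at each site `l` one differentiation of `s(l)` is removed from `l` and, if
  the choice `c l` is the line `p`, added to `p` at `s(l)`; its line dimensions: `a_l + 1` on the sites, `a_p − #{sites hitting
  p}` elsewhere (`lineDim_moveCounts`), and the number of sites hitting `p` in terms of the operation codes of `B3AmpIBPClosed`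
  (`nHit_eq_codes`: one per differentiated variable);
* **the degrees do not decrease and the (2.4)-blocks gain +1** (`D_moveCounts_ge`): for every block `b` of every `G_i`,
  `D′(b) ≥ D(b) + [b is a single site line]`, because a line hit at the site vertex `s(l)` enters the `G_i` after `l`, so
  every block containing it contains `l` (`mem_before_of_hit`); hence under the printed hypothesis (every block is a
  (2.4)-block or has positive degree) ALL blocks of `G′∗_c` have positive degree (`pos_moveCounts`).
-/

open Finset

namespace Literature.MathematicalPhysics.QuantumFieldTheory.Balaban1983to89.B3Ineq213

open B3Ineq215

variable {V : Type} [Fintype V] [DecidableEq V] {m : ℕ}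

/-! ## The count datum of `G′∗_c` -/

/-- The number (0 or 1) of sites at the vertex `v` whose derivative hits the line `p`. [cite: Balaban1983Higgs3, (2.9) p.425] -/
def hitAt (G : Counts V m) (S : Finset (Fin m)) (c : Fin m → Option (Fin m)) (v : V) (p : Fin m) : ℕ :=
  (S.filter fun l => l ≠ p ∧ G.src l = v ∧ c l = some p).card

/-- The number of sites whose derivative hits the line `p`. [cite: Balaban1983Higgs3, (2.9) p.425] -/
def nHit (S : Finset (Fin m)) (c : Fin m → Option (Fin m)) (p : Fin m) : ℕ :=
  (S.filter fun l => l ≠ p ∧ c l = some p).card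

/-- **The count datum of the graph `G′∗_c`**: at every site `l ∈ S` one differentiation of `s(l)` acting on `l` is removed and,
if the choice at `l` is the line `p`, one differentiation of `s(l)` acting on `p` is added (the derivative moved by (2.8) from
the propagator of `l` to the leg of `p` at the same vertex); nothing else changes. [cite: Balaban1983Higgs3, (2.9) p.425] -/
def moveCounts (G : Counts V m) (S : Finset (Fin m)) (c : Fin m → Option (Fin m)) : Counts V m :=
  { G with diffOn := fun v p => G.diffOn v p - (if p ∈ S ∧ v = G.src p then 1 else 0) + hitAt G S c v p }

/-- `G′∗_c` keeps the dimension of `G`. [cite: Balaban1983Higgs3, (2.9) p.425] -/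
@[simp] theorem moveCounts_d (G : Counts V m) (S : Finset (Fin m)) (c : Fin m → Option (Fin m)) :
    (moveCounts G S c).d = G.d := rfl

/-- `G′∗_c` keeps the averaged legs of `G`. [cite: Balaban1983Higgs3, (2.9) p.425] -/
@[simp] theorem moveCounts_vecLegAvg (G : Counts V m) (S : Finset (Fin m)) (c : Fin m → Option (Fin m)) :
    (moveCounts G S c).vecLegAvg = G.vecLegAvg := rfl

/-- The differentiation counts of `G′∗_c`. [cite: Balaban1983Higgs3, (2.9) p.425] -/
theorem moveCounts_diffOn (G : Counts V m) (S : Finset (Fin m)) (c : Fin m → Option (Fin m)) (v : V) (p : Fin m) :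
    (moveCounts G S c).diffOn v p = G.diffOn v p - (if p ∈ S ∧ v = G.src p then 1 else 0) + hitAt G S c v p := rfl

/-- The blocks `G_i` depend on the endpoints of the lines only. [cite: Balaban1983Higgs3, (2.16) p.428] -/
theorem rep_congr {M M' : Model V m} (hs : M.src = M'.src) (ht : M.tgt = M'.tgt) : ∀ i, M.rep i = M'.rep i
  | 0 => rfl
  | i + 1 => by
      funext v
      have ih := rep_congr hs ht i
      simp only [Model.rep, ih, hs, ht]

/-- The blocks of `G′∗_c` are those of `G` (same lines and endpoints). [cite: Balaban1983Higgs3, (2.9) p.425] -/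
theorem moveCounts_rep (G : Counts V m) (S : Finset (Fin m)) (c : Fin m → Option (Fin m)) (i : ℕ) :
    (moveCounts G S c).toModel.rep i = G.toModel.rep i :=
  rep_congr (M := (moveCounts G S c).toModel) (M' := G.toModel) rfl rfl i

/-- The blocks of `G′∗_c` are those of `G`: their lines. [cite: Balaban1983Higgs3, (2.9) p.425] -/
theorem moveCounts_before (G : Counts V m) (S : Finset (Fin m)) (c : Fin m → Option (Fin m)) (i : ℕ) (b : V) :
    (moveCounts G S c).toModel.before i b = G.toModel.before i b := by
  unfold Model.before
  rw [moveCounts_rep]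
  rfl

/-- The blocks of `G′∗_c` are those of `G`: their vertices. [cite: Balaban1983Higgs3, (2.9) p.425] -/
theorem moveCounts_fiber (G : Counts V m) (S : Finset (Fin m)) (c : Fin m → Option (Fin m)) (i : ℕ) (b : V) :
    (moveCounts G S c).toModel.fiber i b = G.toModel.fiber i b := by
  unfold Model.fiber
  rw [moveCounts_rep]

/-- The blocks of `G′∗_c` are those of `G`: their representatives. [cite: Balaban1983Higgs3, (2.9) p.425] -/
theorem moveCounts_reps (G : Counts V m) (S : Finset (Fin m)) (c : Fin m → Option (Fin m)) (i : ℕ) :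
    (moveCounts G S c).toModel.reps i = G.toModel.reps i := by
  unfold Model.reps
  rw [moveCounts_rep]

/-- The blocks of `G′∗_c` are those of `G`: the components. [cite: Balaban1983Higgs3, (2.9) p.425] -/
theorem moveCounts_nontriv (G : Counts V m) (S : Finset (Fin m)) (c : Fin m → Option (Fin m)) (i : ℕ) (b : V) :
    (moveCounts G S c).toModel.Nontriv i b ↔ G.toModel.Nontriv i b := by
  unfold Model.Nontriv
  rw [moveCounts_before]

/-- Summing the hits on `p` over the vertices counts the sites hitting `p`. [cite: Balaban1983Higgs3, (2.9) p.425] -/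
theorem sum_hitAt (G : Counts V m) (S : Finset (Fin m)) (c : Fin m → Option (Fin m)) (p : Fin m) :
    ∑ v, hitAt G S c v p = nHit S c p := by
  unfold hitAt nHit
  rw [card_eq_sum_card_fiberwise (f := G.src) (t := univ) (fun l _ => mem_univ _)]
  refine sum_congr rfl fun v _ => ?_
  congr 1
  ext l
  simp only [mem_filter]
  tauto

/-- The leg exponents of `G′∗_c`: `+1` at `(s(l), l)` for the sites (when a differentiation was there), `−hitAt` where hit.
[cite: Balaban1983Higgs3, (2.9) p.425] -/
theorem legExp_moveCounts (G : Counts V m) {S : Finset (Fin m)} (hS : ∀ l ∈ S, 1 ≤ G.diffOn (G.src l) l)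
    (c : Fin m → Option (Fin m)) (v : V) (p : Fin m) :
    (moveCounts G S c).legExp v p
      = G.legExp v p + (if p ∈ S ∧ v = G.src p then 1 else 0) - hitAt G S c v p := by
  have hlegs : (moveCounts G S c).legsOn v p = G.legsOn v p := rfl
  unfold Counts.legExp
  rw [hlegs, moveCounts_diffOn, moveCounts_d, moveCounts_vecLegAvg]
  by_cases h : p ∈ S ∧ v = G.src p
  · have h1 : 1 ≤ G.diffOn v p := h.2 ▸ hS p h.1
    rw [if_pos h, if_pos h, Nat.cast_add, Nat.cast_sub h1, Nat.cast_one]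
    ring
  · rw [if_neg h, if_neg h, Nat.sub_zero, Nat.cast_add]
    ring

/-- **The line dimensions of `G′∗_c`**: `a_l + 1` on the sites, `a_p − #{sites hitting p}` in general.
[cite: Balaban1983Higgs3, (2.9) p.425] -/
theorem lineDim_moveCounts (G : Counts V m) {S : Finset (Fin m)} (hS : ∀ l ∈ S, 1 ≤ G.diffOn (G.src l) l)
    (c : Fin m → Option (Fin m)) (p : Fin m) :
    (moveCounts G S c).lineDim p = G.lineDim p + (if p ∈ S then 1 else 0) - (nHit S c p : ℝ) := by
  unfold Counts.lineDim
  simp_rw [legExp_moveCounts G hS]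
  rw [sum_sub_distrib, sum_add_distrib, ← Nat.cast_sum, sum_hitAt]
  congr 2
  by_cases hp : p ∈ S
  · simp only [hp, true_and, if_true]
    rw [Finset.sum_ite_eq' univ (G.src p) (fun _ => (1 : ℝ))]
    simp
  · simp [hp]

/-- The model of `G′∗_c` has the line dimensions of `lineDim_moveCounts`, everything else as `G`. [cite: Balaban1983Higgs3, (2.9) p.425] -/
theorem toModel_a_moveCounts (G : Counts V m) {S : Finset (Fin m)} (hS : ∀ l ∈ S, 1 ≤ G.diffOn (G.src l) l)
    (c : Fin m → Option (Fin m)) (p : Fin m) :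
    (moveCounts G S c).toModel.a p = G.toModel.a p + (if p ∈ S then 1 else 0) - (nHit S c p : ℝ) :=
  lineDim_moveCounts G hS c p

/-! ## The number of hits in terms of the operation codes -/

/-- A supremum of operation codes equals `2` iff one of the choices is the line itself. [cite: Balaban1983Higgs3, (2.9) p.425] -/
theorem sup_opCode_eq_two_iff (T : Finset (Fin m)) (c : Fin m → Option (Fin m)) (p : Fin m) :
    T.sup (fun l => opCode (c l) p) = 2 ↔ ∃ l ∈ T, c l = some p := by
  constructor
  · intro h
    by_cases hne : T.Nonempty
    · obtain ⟨l, hl, hl2⟩ := exists_mem_eq_sup _ hne (fun l => opCode (c l) p)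
      rw [h] at hl2
      refine ⟨l, hl, ?_⟩
      cases hcl : c l with
      | none => rw [hcl] at hl2; simp at hl2
      | some q =>
        rw [hcl, opCode_some] at hl2
        by_cases hpq : p = q
        · rw [hpq]
        · rw [if_neg hpq] at hl2
          have hle : (if q < p then (1 : ℕ) else 0) ≤ 1 := by split_ifs <;> omega
          omega
    · rw [not_nonempty_iff_eq_empty.1 hne, sup_empty] at h
      exact absurd h (by decide)
  · rintro ⟨l, hl, hcl⟩
    apply le_antisymm
    · exact Finset.sup_le fun l' _ => opCode_le_two _ _
    · have : opCode (c l) p = 2 := by rw [hcl, opCode_some, if_pos rfl]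
      rw [← this]
      exact le_sup (f := fun l => opCode (c l) p) hl

/-- The first variable of `p` is differentiated (`xcode = 2`) iff a site at `s(p)` hits `p`. [cite: Balaban1983Higgs3, (2.9) p.425] -/
theorem xcode_eq_two_iff (G : Counts V m) (S : Finset (Fin m)) (c : Fin m → Option (Fin m)) (p : Fin m) :
    xcode G.src S c p = 2 ↔ ∃ l ∈ S, l ≠ p ∧ G.src l = G.src p ∧ c l = some p := by
  unfold xcode
  rw [sup_opCode_eq_two_iff]
  constructor
  · rintro ⟨l, hl, hc⟩
    obtain ⟨hS, hp, hs⟩ := mem_filter.1 hl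
    exact ⟨l, hS, hp, hs, hc⟩
  · rintro ⟨l, hS, hp, hs, hc⟩
    exact ⟨l, mem_filter.2 ⟨hS, hp, hs⟩, hc⟩

/-- The second variable of `p` is differentiated (`ycode = 2`) iff a site at `t(p)` hits `p`. [cite: Balaban1983Higgs3, (2.9) p.425] -/
theorem ycode_eq_two_iff (G : Counts V m) (S : Finset (Fin m)) (c : Fin m → Option (Fin m)) (p : Fin m) :
    ycode G.src G.tgt S c p = 2 ↔ ∃ l ∈ S, l ≠ p ∧ G.src l = G.tgt p ∧ c l = some p := by
  unfold ycode
  rw [sup_opCode_eq_two_iff]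
  constructor
  · rintro ⟨l, hl, hc⟩
    obtain ⟨hS, hp, hs⟩ := mem_filter.1 hl
    exact ⟨l, hS, hp, hs, hc⟩
  · rintro ⟨l, hS, hp, hs, hc⟩
    exact ⟨l, mem_filter.2 ⟨hS, hp, hs⟩, hc⟩

/-- **The number of sites hitting a non-site line `p` is the number of its differentiated variables** (one variable for a loop):
for a site set (distinct site vertices) and a valid choice function. [cite: Balaban1983Higgs3, (2.9) p.425] -/
theorem nHit_eq_codes (G : Counts V m) {S : Finset (Fin m)} (hS : IsSiteSet G.src G.tgt S) {c : Fin m → Option (Fin m)}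
    (hc : c ∈ choices G.src G.tgt S) (p : Fin m) :
    nHit S c p = (if xcode G.src S c p = 2 then 1 else 0)
      + (if G.src p ≠ G.tgt p ∧ ycode G.src G.tgt S c p = 2 then 1 else 0) := by
  classical
  -- the hitting sites sit at `s(p)` or at `t(p)`
  set A := S.filter fun l => l ≠ p ∧ c l = some p with hA
  have hAst : ∀ l ∈ A, G.src l = G.src p ∨ G.src l = G.tgt p := by
    intro l hl
    obtain ⟨-, -, hcl⟩ := mem_filter.1 hl
    obtain ⟨-, -, h⟩ := choice_some G.src G.tgt hc hcl
    rcases h with h | h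
    · exact Or.inl h.symm
    · exact Or.inr h.symm
  -- at most one site per vertex
  have hcard1 : ∀ w : V, (A.filter fun l => G.src l = w).card ≤ 1 := by
    intro w
    rw [card_le_one]
    intro l hl l' hl'
    by_contra hne
    exact hS.src_ne_src l (mem_filter.1 (mem_filter.1 hl).1).1 l' (mem_filter.1 (mem_filter.1 hl').1).1 hne
      ((mem_filter.1 hl).2.trans (mem_filter.1 hl').2.symm)
  -- the indicator of a nonempty sub-singleton is its cardinality
  have hind : ∀ w : V, (A.filter fun l => G.src l = w).card
      = if (∃ l ∈ S, l ≠ p ∧ G.src l = w ∧ c l = some p) then 1 else 0 := by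
    intro w
    by_cases h : ∃ l ∈ S, l ≠ p ∧ G.src l = w ∧ c l = some p
    · rw [if_pos h]
      obtain ⟨l, hlS, hlp, hls, hcl⟩ := h
      have hl : l ∈ A.filter (fun l => G.src l = w) := mem_filter.2 ⟨mem_filter.2 ⟨hlS, hlp, hcl⟩, hls⟩
      exact le_antisymm (hcard1 w) (card_pos.2 ⟨l, hl⟩)
    · rw [if_neg h, card_eq_zero, filter_eq_empty_iff]
      intro l hl hls
      obtain ⟨hlS, hlp, hcl⟩ := mem_filter.1 hl
      exact h ⟨l, hlS, hlp, hls, hcl⟩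
  unfold nHit
  rw [← hA]
  have hx : (if xcode G.src S c p = 2 then 1 else 0) = (A.filter fun l => G.src l = G.src p).card := by
    rw [hind]
    by_cases h : ∃ l ∈ S, l ≠ p ∧ G.src l = G.src p ∧ c l = some p
    · rw [if_pos ((xcode_eq_two_iff G S c p).2 h), if_pos h]
    · rw [if_neg (fun h' => h ((xcode_eq_two_iff G S c p).1 h')), if_neg h]
  rw [hx]
  by_cases hloop : G.src p = G.tgt p
  · -- a loop: every hitting site sits at the one vertex
    have hAll : A.filter (fun l => G.src l = G.src p) = A := by
      refine filter_true_of_mem fun l hl => ?_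
      rcases hAst l hl with h | h
      · exact h
      · exact h.trans hloop.symm
    rw [hAll, if_neg (fun h => h.1 hloop), add_zero]
  · have hy : (if G.src p ≠ G.tgt p ∧ ycode G.src G.tgt S c p = 2 then 1 else 0)
        = (A.filter fun l => G.src l = G.tgt p).card := by
      rw [hind]
      by_cases h : ∃ l ∈ S, l ≠ p ∧ G.src l = G.tgt p ∧ c l = some p
      · rw [if_pos ⟨hloop, (ycode_eq_two_iff G S c p).2 h⟩, if_pos h]
      · rw [if_neg (fun h' => h ((ycode_eq_two_iff G S c p).1 h'.2)), if_neg h]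
    have hneg : A.filter (fun l => ¬ G.src l = G.src p) = A.filter (fun l => G.src l = G.tgt p) := by
      ext l
      simp only [mem_filter]
      constructor
      · rintro ⟨hl, h⟩; exact ⟨hl, (hAst l hl).resolve_left h⟩
      · rintro ⟨hl, h⟩; exact ⟨hl, fun h' => hloop (h'.symm.trans h)⟩
    have hsplit : (A.filter fun l => G.src l = G.src p).card + (A.filter fun l => G.src l = G.tgt p).card = A.card := by
      rw [← hneg]
      exact card_filter_add_card_filter_not _
    rw [hy, hsplit]

/-! ## Degrees of the blocks of `G′∗_c` -/

/-- The hits summed over a set of lines, regrouped by the hitting site. [cite: Balaban1983Higgs3, (2.9) p.425] -/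
theorem sum_nHit (S : Finset (Fin m)) (c : Fin m → Option (Fin m)) (B : Finset (Fin m)) :
    ∑ p ∈ B, nHit S c p = ∑ l ∈ S, (B.filter fun p => p ≠ l ∧ c l = some p).card := by
  unfold nHit
  simp only [card_filter]
  rw [sum_comm]
  refine sum_congr rfl fun l _ => sum_congr rfl fun p _ => ?_
  simp only [ne_comm]

/-- The lines of `B` that are sites, counted over the sites. [cite: Balaban1983Higgs3, (2.9) p.425] -/
theorem sum_mem_indicator (S B : Finset (Fin m)) :
    ∑ p ∈ B, (if p ∈ S then (1 : ℝ) else 0) = ∑ l ∈ S, (if l ∈ B then (1 : ℝ) else 0) := by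
  rw [Finset.sum_ite_mem, Finset.sum_ite_mem, inter_comm]

/-- At most one line is hit by a given site, and a site hitting INTO the block `B` of some `G_i` lies in `B`: the site's term
`[l ∈ B] − #{p ∈ B hit by l}` is non-negative. [cite: Balaban1983Higgs3, (2.9) p.425] -/
theorem site_term_nonneg (G : Counts V m) {S : Finset (Fin m)} (hS : S ⊆ sites G) {c : Fin m → Option (Fin m)}
    (hc : c ∈ choices G.src G.tgt S) {l : Fin m} (hl : l ∈ S) (i : ℕ) (b : V) :
    (0 : ℝ) ≤ (if l ∈ G.toModel.before i b then (1 : ℝ) else 0)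
      - ((G.toModel.before i b).filter fun p => p ≠ l ∧ c l = some p).card := by
  set F := (G.toModel.before i b).filter fun p => p ≠ l ∧ c l = some p with hF
  by_cases hne : F.Nonempty
  · obtain ⟨p, hp⟩ := hne
    obtain ⟨hpB, hpl, hcl⟩ := mem_filter.1 hp
    obtain ⟨-, -, ht⟩ := choice_some G.src G.tgt hc hcl
    have hlB : l ∈ G.toModel.before i b := mem_before_of_hit (mem_sites.1 (hS hl)).2.2 hpl ht hpB
    have hcard : F.card ≤ 1 := by
      rw [card_le_one]
      intro q hq q' hq'
      have h1 := (mem_filter.1 hq).2.2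
      have h2 := (mem_filter.1 hq').2.2
      rw [h1] at h2
      exact Option.some_injective _ h2
    rw [if_pos hlB]
    have : (F.card : ℝ) ≤ 1 := by exact_mod_cast hcard
    linarith
  · rw [not_nonempty_iff_eq_empty.1 hne, card_empty, Nat.cast_zero, sub_zero]
    split_ifs <;> norm_num

/-- The term of the site whose own block `{l}` is `B`: exactly `1` (nothing in `{l}` is hit by `l`). [cite: Balaban1983Higgs3, (2.9) p.425] -/
theorem site_term_self (G : Counts V m) {S : Finset (Fin m)} {c : Fin m → Option (Fin m)} {l : Fin m} {i : ℕ} {b : V}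
    (hB : G.toModel.before i b = {l}) :
    (if l ∈ G.toModel.before i b then (1 : ℝ) else 0)
      - ((G.toModel.before i b).filter fun p => p ≠ l ∧ c l = some p).card = 1 := by
  have hemp : ((G.toModel.before i b).filter fun p => p ≠ l ∧ c l = some p) = ∅ := by
    rw [hB, filter_eq_empty_iff]
    intro p hp h
    exact h.1 (mem_singleton.1 hp)
  have _hS := S
  rw [hemp, card_empty, Nat.cast_zero, sub_zero, if_pos (by rw [hB]; exact mem_singleton_self _)]

/-- **The degrees of the blocks of `G′∗_c` versus those of `G`**: `D′(b) = D(b) + Σ_{l ∈ S} ([l ∈ b] − #{p ∈ b hit by l})`.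
[cite: Balaban1983Higgs3, (2.9) p.425] -/
theorem D_moveCounts_eq (G : Counts V m) {S : Finset (Fin m)} (hS : ∀ l ∈ S, 1 ≤ G.diffOn (G.src l) l)
    (c : Fin m → Option (Fin m)) (i : ℕ) (b : V) :
    (moveCounts G S c).toModel.D i b = G.toModel.D i b
      + ∑ l ∈ S, ((if l ∈ G.toModel.before i b then (1 : ℝ) else 0)
          - ((G.toModel.before i b).filter fun p => p ≠ l ∧ c l = some p).card) := by
  have hD : ∀ (M : Model V m), M.D i b = (∑ v ∈ M.fiber i b, ((M.d : ℝ) + M.e v)) - M.d + ∑ l ∈ M.before i b, M.a l :=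
    fun _ => rfl
  rw [hD, hD, moveCounts_fiber, moveCounts_before]
  have ha : ∀ p, (moveCounts G S c).toModel.a p = G.toModel.a p + (if p ∈ S then 1 else 0) - (nHit S c p : ℝ) :=
    toModel_a_moveCounts G hS c
  have hn : ∑ x ∈ G.toModel.before i b, (nHit S c x : ℝ)
      = ∑ l ∈ S, (((G.toModel.before i b).filter fun p => p ≠ l ∧ c l = some p).card : ℝ) := by
    rw [← Nat.cast_sum, sum_nHit, Nat.cast_sum]
  have hsumA : ∑ l ∈ G.toModel.before i b, (moveCounts G S c).toModel.a l
      = ∑ l ∈ G.toModel.before i b, G.toModel.a l + ∑ l ∈ S, (if l ∈ G.toModel.before i b then (1 : ℝ) else 0)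
        - ∑ l ∈ S, (((G.toModel.before i b).filter fun p => p ≠ l ∧ c l = some p).card : ℝ) := by
    simp only [ha]
    rw [sum_sub_distrib, sum_add_distrib, sum_mem_indicator, hn]
  have hd : ((moveCounts G S c).toModel.d : ℝ) = G.toModel.d := rfl
  have he : ∀ v, (moveCounts G S c).toModel.e v = G.toModel.e v := fun _ => rfl
  simp only [hd, he, hsumA]
  rw [sum_sub_distrib]
  ring

/-- **Degrees do not decrease, and the (2.4)-blocks gain +1**: for `S ⊆ sites G` and a valid choice function, every block
`b` of every `G_i` satisfies `D(b) + [b is a single site line of S] ≤ D′(b)` — p. 425: *"the graphs (2.4) are replaced by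
the graphs with degree +1 … the degrees of these graphs are ≧ D(G₀)"*. [cite: Balaban1983Higgs3, (2.9) p.425] -/
theorem D_moveCounts_ge (G : Counts V m) {S : Finset (Fin m)} (hS : S ⊆ sites G) {c : Fin m → Option (Fin m)}
    (hc : c ∈ choices G.src G.tgt S) (i : ℕ) (b : V) :
    G.toModel.D i b + (if ∃ l ∈ S, G.toModel.before i b = {l} then 1 else 0) ≤ (moveCounts G S c).toModel.D i b := by
  have hS1 : ∀ l ∈ S, 1 ≤ G.diffOn (G.src l) l := fun l hl => (mem_sites.1 (hS hl)).2.1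
  rw [D_moveCounts_eq G hS1 c i b]
  have hnn := fun l (hl : l ∈ S) => site_term_nonneg G hS hc hl i b
  by_cases h : ∃ l ∈ S, G.toModel.before i b = {l}
  · rw [if_pos h]
    obtain ⟨l₀, hl₀, hB⟩ := h
    have h1 := site_term_self G (S := S) (c := c) hB
    have hle := single_le_sum (f := fun l => (if l ∈ G.toModel.before i b then (1 : ℝ) else 0)
      - (((G.toModel.before i b).filter fun p => p ≠ l ∧ c l = some p).card : ℝ)) hnn hl₀
    simp only [h1] at hle
    linarith
  · rw [if_neg h, add_zero]
    have := sum_nonneg hnn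
    linarith

/-- **All blocks of `G′∗_c` have positive degree** under the printed hypothesis *"each connected subgraph, with the possible
exception of the subgraphs (2.4), has a positive degree"* (read on the blocks of the `G_i`), for `S = sites G` and every valid
choice function — p. 426: *"for each graph G′∗ the subgraphs G₁, G₂, …, G_m = G′∗ defined as previously have positive degrees"*.
[cite: Balaban1983Higgs3, Prop. 2.1 p.426] -/
theorem pos_moveCounts (G : Counts V m) {c : Fin m → Option (Fin m)} (hc : c ∈ choices G.src G.tgt (sites G))
    (hyp : ∀ i, i ≤ m → ∀ b ∈ G.toModel.reps i, G.toModel.Nontriv i b → Is24Block G i b ∨ 0 < G.toModel.D i b) :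
    ∀ i, i ≤ m → ∀ b ∈ (moveCounts G (sites G) c).toModel.reps i, (moveCounts G (sites G) c).toModel.Nontriv i b →
      0 < (moveCounts G (sites G) c).toModel.D i b := by
  intro i hi b hb hn
  rw [moveCounts_reps] at hb
  rw [moveCounts_nontriv] at hn
  have hge := D_moveCounts_ge G (subset_refl (sites G)) hc i b
  rcases hyp i hi b hb hn with h24 | hpos
  · obtain ⟨l, hl, hB⟩ := h24.exists_site
    rw [if_pos ⟨l, hl, hB⟩] at hge
    have hD : G.toModel.D i b = 0 := by
      rw [← cast_degQ, h24.1]; norm_num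
    linarith
  · have : (0 : ℝ) ≤ (if ∃ l ∈ sites G, G.toModel.before i b = {l} then 1 else 0) := by split_ifs <;> norm_num
    linarith

end Literature.MathematicalPhysics.QuantumFieldTheory.Balaban1983to89.B3Ineq213
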